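import Summits.KontsevichZagierPeriods.KontsevichZagierPeriods.Theorems.RootDecompRelativeModAbsoluteCircleSplitP09

/-! # `RootDecompRelativeModAbsoluteCircleSplitP10` — part 10/11 of the mechanical ≤400-line split of `csk_min.lean` (sha256 066c56c743abe73e…)
Source: decomp-kz lens-3 g14 CircleSplitK.lean @3d3b9378 (= CircleSplit @d1112051 §0–§25 + §26 kernel split + §27 odd→log; critic CLEARED g6-21 l.1371, g7-2 l.1388) minus the 65 declarations already landed in …CircleLogP1–P11 / …CylLogSplitP46–P49 and minus the 20 superseded g13-glue/tame-class lemmas not on the §26–§27 chain; imports …CylLogSplitP48 + …CircleLogP11; --supports stmt-KontsevichZagierPeriods-30572.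
Split by census-1 g10 `gen/splitlean.py`: scopes re-opened with their `open`/`variable`/`set_option` context; mathematics and declaration order unchanged. -/

noncomputable section
open Set MeasureTheory Filter Topology
open scoped BigOperators
open Literature.NumberTheory.Transcendental Literature.ModelTheory.ExponentialFields
namespace Summit.KontsevichZagierPeriods.RootDecompRelativeModAbsolute.Rung30571.RegularisedLogLayer.CylLog.Leaf
open Set MeasureTheory Filter Topology in
open scoped BigOperators in
open Literature.NumberTheory.Transcendental Literature.ModelTheory.ExponentialFields in
/-- Auxiliary step `eq_snoc_init_zero_add''` (§27): eq snoc init zero add''. [bookkeeping] -/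
private theorem eq_snoc_init_zero_add'' (m : ℕ) (w : Fin (m + 1) → ℝ) :
    w = Fin.snoc (Fin.init w) (0 : ℝ) + w (Fin.last m) • (Pi.single (Fin.last m) (1 : ℝ) : Fin (m + 1) → ℝ) := by
  ext i
  refine Fin.lastCases ?_ (fun j => ?_) i
  · simp
  · simp [(Fin.castSucc_lt_last j).ne, Fin.init]

namespace G13
variable {b : ℕ}
namespace KernelSplit
section Subst
variable {m : ℕ}

/-- Derivative and Jacobian determinant of the substitution map. -/
theorem subst_calculus (ψ ψs : (Fin (m + 1) → ℝ) → ℝ) (D : Set (Fin (m + 1) → ℝ))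
    (hψd : ∀ z ∈ D, DifferentiableAt ℝ ψ z)
    (hψs : ∀ z ∈ D, HasDerivAt (fun t : ℝ => ψ (Fin.snoc (Fin.init z) t)) (ψs z) (z (Fin.last m))) :
    ∃ Φ' : (Fin (m + 1) → ℝ) → (Fin (m + 1) → ℝ) →L[ℝ] (Fin (m + 1) → ℝ),
      (∀ z ∈ D, HasFDerivAt (substMap ψ) (Φ' z) z) ∧ (∀ z ∈ D, (Φ' z).det = ψs z) := by
  let Φ' : (Fin (m + 1) → ℝ) → (Fin (m + 1) → ℝ) →L[ℝ] (Fin (m + 1) → ℝ) := fun z =>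
    ContinuousLinearMap.pi
      (Fin.lastCases (motive := fun _ => (Fin (m + 1) → ℝ) →L[ℝ] ℝ) (fderiv ℝ ψ z)
        (fun i => ContinuousLinearMap.proj (Fin.castSucc i)))
  have hΦ' : ∀ z w, Φ' z w = Fin.snoc (Fin.init w) (fderiv ℝ ψ z w) := by
    intro z w
    funext i
    refine Fin.lastCases ?_ (fun j => ?_) i
    · simp [Φ']
    · simp [Φ', Fin.init]
  have hlast : ∀ z ∈ D, fderiv ℝ ψ z (Pi.single (Fin.last m) 1) = ψs z := by
    intro z hz
    have hγ : HasDerivAt (fun t : ℝ => (Fin.snoc (Fin.init z) t : Fin (m + 1) → ℝ))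
        (Pi.single (Fin.last m) (1 : ℝ)) (z (Fin.last m)) := by
      rw [hasDerivAt_pi]
      intro i
      refine Fin.lastCases ?_ (fun j => ?_) i
      · simpa using hasDerivAt_id' (z (Fin.last m))
      · simpa [(Fin.castSucc_lt_last j).ne, Fin.init] using hasDerivAt_const (z (Fin.last m)) (z (Fin.castSucc j))
    have h1 : HasDerivAt (fun t : ℝ => ψ (Fin.snoc (Fin.init z) t))
        (fderiv ℝ ψ z (Pi.single (Fin.last m) 1)) (z (Fin.last m)) := by
      have hψz : HasFDerivAt ψ (fderiv ℝ ψ z) (Fin.snoc (Fin.init z) (z (Fin.last m))) := by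
        rw [Fin.snoc_init_self]
        exact (hψd z hz).hasFDerivAt
      exact hψz.comp_hasDerivAt (z (Fin.last m)) hγ
    exact h1.unique (hψs z hz)
  have hdet : ∀ z ∈ D, (Φ' z).det = ψs z := by
    intro z hz
    let E : (Fin m → ℝ) →ₗ[ℝ] (Fin (m + 1) → ℝ) :=
      LinearMap.pi (Fin.lastCases (motive := fun _ => (Fin m → ℝ) →ₗ[ℝ] ℝ) 0
        (fun i => LinearMap.proj i))
    have hE : ∀ y, E y = Fin.snoc y 0 := by
      intro y
      funext i
      refine Fin.lastCases ?_ (fun j => ?_) i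
      · simp [E]
      · simp [E]
    have h := LinearMap.det_of_snoc_init (Φ' z : (Fin (m + 1) → ℝ) →ₗ[ℝ] (Fin (m + 1) → ℝ))
      LinearMap.id ((fderiv ℝ ψ z : (Fin (m + 1) → ℝ) →ₗ[ℝ] ℝ).comp E)
      (fderiv ℝ ψ z (Pi.single (Fin.last m) 1)) (fun w => by
        rw [ContinuousLinearMap.coe_coe, hΦ', LinearMap.id_apply, LinearMap.comp_apply,
          ContinuousLinearMap.coe_coe, hE]
        congr 1
        conv_lhs => rw [eq_snoc_init_zero_add'' m w]
        rw [map_add, map_smul, smul_eq_mul, mul_comm])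
    rw [LinearMap.det_id, mul_one, hlast z hz] at h
    exact h
  have hderiv : ∀ z ∈ D, HasFDerivAt (substMap ψ) (Φ' z) z := by
    intro z hz
    rw [hasFDerivAt_pi']
    intro i
    refine Fin.lastCases ?_ (fun j => ?_) i
    · have hfun : (fun x => substMap ψ x (Fin.last m)) = ψ := by
        funext x
        simp [substMap]
      show HasFDerivAt (fun x => substMap ψ x (Fin.last m)) _ z
      rw [hfun]
      refine (hψd z hz).hasFDerivAt.congr_fderiv (ContinuousLinearMap.ext fun w => ?_)
      simp [hΦ']
    · have hfun : (fun x => substMap ψ x (Fin.castSucc j)) = fun x => x (Fin.castSucc j) := by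
        funext x
        simp [substMap, Fin.init]
      show HasFDerivAt (fun x => substMap ψ x (Fin.castSucc j)) _ z
      rw [hfun]
      refine (hasFDerivAt_apply (Fin.castSucc j) z).congr_fderiv
        (ContinuousLinearMap.ext fun w => ?_)
      simp [hΦ', Fin.init]
  exact ⟨Φ', hderiv, hdet⟩

open MvPolynomial in
/-- Auxiliary step `isSemialgebraicMapOn_substMap`: is Semialgebraic Map On subst Map. [bookkeeping] -/
theorem isSemialgebraicMapOn_substMap {D : Set (Fin (m + 1) → ℝ)} (hD : IsSemialgebraic ℚ D)
    {ψ : (Fin (m + 1) → ℝ) → ℝ} (hψ : IsSemialgebraicFunOn ℚ D ψ) :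
    IsSemialgebraicMapOn ℚ D (substMap ψ) := by
  refine (isSemialgebraicMapOn_iff_forall_holds hD).mpr fun i => ?_
  refine Fin.lastCases ?_ (fun j => ?_) i
  · exact hψ.congr fun z _ => by simp [substMap]
  · exact (isSemialgebraicFunOn_aeval hD (MvPolynomial.X (Fin.castSucc j))).congr fun z _ => by
      simp [substMap, Fin.init]

/-- Auxiliary step `injOn_substMap`: inj On subst Map. [bookkeeping] -/
theorem injOn_substMap {D : Set (Fin (m + 1) → ℝ)} {ψ : (Fin (m + 1) → ℝ) → ℝ}
    (hinj : ∀ z₁ ∈ D, ∀ z₂ ∈ D, Fin.init z₁ = Fin.init z₂ → ψ z₁ = ψ z₂ →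
      z₁ (Fin.last m) = z₂ (Fin.last m)) : InjOn (substMap ψ) D := by
  intro z₁ hz₁ z₂ hz₂ h
  have hy : Fin.init z₁ = Fin.init z₂ := by
    have := congrArg Fin.init h
    simpa [substMap] using this
  have hl : ψ z₁ = ψ z₂ := by
    have := congrFun h (Fin.last m)
    simpa [substMap] using this
  rw [← Fin.snoc_init_self z₁, ← Fin.snoc_init_self z₂, hy, hinj z₁ hz₁ z₂ hz₂ hy hl]

/-- **KZ rule 2 for a fibre substitution on an arbitrary domain.** -/
private theorem of_sub_of_mem_relations_of_subst (ψ ψs : (Fin (m + 1) → ℝ) → ℝ) (r r' : KZ.IntegralRep (m + 1))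
    (hψ : IsSemialgebraicFunOn ℚ r.domain ψ) (hψd : ∀ z ∈ r.domain, DifferentiableAt ℝ ψ z)
    (hψs : ∀ z ∈ r.domain, HasDerivAt (fun t : ℝ => ψ (Fin.snoc (Fin.init z) t)) (ψs z) (z (Fin.last m)))
    (hinj : ∀ z₁ ∈ r.domain, ∀ z₂ ∈ r.domain, Fin.init z₁ = Fin.init z₂ → ψ z₁ = ψ z₂ →
      z₁ (Fin.last m) = z₂ (Fin.last m))
    (hr' : r'.domain = substMap ψ '' r.domain)
    (hint : ∀ z ∈ r.domain, r.integrand z = r'.integrand (substMap ψ z) * |ψs z|) :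
    KZ.of r - KZ.of r' ∈ KZ.relations := by
  obtain ⟨Φ', hderiv, hdet⟩ := subst_calculus ψ ψs r.domain hψd hψs
  refine KZ.changeOfVariablesRel_subset_relations ⟨m + 1, r, r', substMap ψ, Φ',
    isSemialgebraicMapOn_substMap r.isSemialgebraic_domain hψ, fun z hz => (hderiv z hz).hasFDerivWithinAt,
    injOn_substMap hinj, hr', fun z hz => ?_, rfl⟩
  rw [hint z hz, hdet z hz]

/-- Integrability transport along the substitution. -/
private theorem integrableOn_image_substMap_iff {D : Set (Fin (m + 1) → ℝ)} (hDm : MeasurableSet D)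
    (ψ ψs : (Fin (m + 1) → ℝ) → ℝ) (hψd : ∀ z ∈ D, DifferentiableAt ℝ ψ z)
    (hψs : ∀ z ∈ D, HasDerivAt (fun t : ℝ => ψ (Fin.snoc (Fin.init z) t)) (ψs z) (z (Fin.last m)))
    (hinj : ∀ z₁ ∈ D, ∀ z₂ ∈ D, Fin.init z₁ = Fin.init z₂ → ψ z₁ = ψ z₂ →
      z₁ (Fin.last m) = z₂ (Fin.last m)) (g : (Fin (m + 1) → ℝ) → ℝ) :
    IntegrableOn g (substMap ψ '' D) ↔ IntegrableOn (fun z => |ψs z| * g (substMap ψ z)) D := by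
  obtain ⟨Φ', hderiv, hdet⟩ := subst_calculus ψ ψs D hψd hψs
  rw [integrableOn_image_iff_integrableOn_abs_det_fderiv_smul (μ := volume) hDm
    (fun z hz => (hderiv z hz).hasFDerivWithinAt) (injOn_substMap hinj) g]
  refine integrableOn_congr_fun (fun z hz => ?_) hDm
  rw [hdet z hz, smul_eq_mul]

end Subst

end KernelSplit

/-- The one-variable substitution `θ' = θ²`: `∫₀¹ θ^{2j+1}/(1+θ²κ) dθ = ½ ∫₀¹ t^j/(1+tκ) dt` (`κ > −1`). -/
theorem integral_oddSq_eq_half (j : ℕ) {κ : ℝ} (hκ1 : -1 < κ) :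
    ∫ θ in Set.Ioo (0:ℝ) 1, θ ^ (2 * j + 1) / (1 + θ ^ 2 * κ) =
      (∫ t in Set.Ioo (0:ℝ) 1, t ^ j / (1 + t * κ)) / 2 := by
  have hden : ∀ t ∈ Set.Icc (0:ℝ) 1, 0 < 1 + t * κ := by
    intro t ht
    rcases le_or_gt 0 κ with hk | hk
    · have : 0 ≤ t * κ := mul_nonneg ht.1 hk
      linarith
    · have : t * κ ≥ 1 * κ := by nlinarith [ht.2]
      linarith
  have hg : ContinuousOn (fun t : ℝ => t ^ j / (1 + t * κ) / 2) (Set.Icc 0 1) := by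
    refine ContinuousOn.div_const (ContinuousOn.div (continuousOn_pow j) ?_ fun t ht => (hden t ht).ne') 2
    exact (continuousOn_const.add (continuousOn_id.mul continuousOn_const))
  have himg : (fun θ : ℝ => θ ^ 2) '' Set.uIcc (0:ℝ) 1 ⊆ Set.Icc 0 1 := by
    rw [Set.uIcc_of_le zero_le_one]
    rintro _ ⟨θ, hθ, rfl⟩
    exact ⟨by positivity, by nlinarith [hθ.1, hθ.2]⟩
  have hsub := intervalIntegral.integral_comp_mul_deriv' (a := (0:ℝ)) (b := 1) (f := fun θ : ℝ => θ ^ 2)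
    (f' := fun θ : ℝ => 2 * θ) (g := fun t : ℝ => t ^ j / (1 + t * κ) / 2)
    (fun θ _ => by simpa using hasDerivAt_pow 2 θ)
    (continuousOn_const.mul continuousOn_id) (hg.mono himg)
  simp only [Function.comp] at hsub
  rw [zero_pow two_ne_zero, one_pow] at hsub
  have hL : ∫ θ in Set.Ioo (0:ℝ) 1, θ ^ (2 * j + 1) / (1 + θ ^ 2 * κ) =
      ∫ θ in (0:ℝ)..1, (θ ^ 2) ^ j / (1 + θ ^ 2 * κ) / 2 * (2 * θ) := by
    rw [← integral_Ioc_eq_integral_Ioo, ← intervalIntegral.integral_of_le zero_le_one]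
    refine intervalIntegral.integral_congr fun θ _ => ?_
    simp only [pow_succ]
    ring
  rw [hL, hsub, intervalIntegral.integral_of_le zero_le_one, integral_Ioc_eq_integral_Ioo,
    MeasureTheory.integral_div]

open scoped ContDiff in
/-- **`CellCloseCEven`** — `CellCloseC` WITHOUT `∃ i, e i = 2` and WITH `∀ i, e i = 2 → M i % 2 = 0`. -/
def CellCloseCEven : Prop :=
  ∀ (D : Set (Fin 1 → ℝ)) (V : KZ.IntegralRep (1 + 1)) (a₀ : (Fin 1 → ℝ) → ℝ) (q : ℕ)
    (c κ : Fin q → (Fin 1 → ℝ) → ℝ) (M e : Fin q → ℕ) (σ : Fin q → Fin 3),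
    IsOpen D → IsSemialgebraic ℚ D →
    IsSemialgebraicFunOn ℚ D a₀ → ContDiffOn ℝ ∞ a₀ D → IntegrableOn a₀ D →
    (∀ i, IsSemialgebraicFunOn ℚ D (c i)) → (∀ i, ContDiffOn ℝ ∞ (c i) D) →
    (∀ i, IsSemialgebraicFunOn ℚ D (κ i)) → (∀ i, ContDiffOn ℝ ∞ (κ i) D) →
    (∀ i, e i = 1 ∨ e i = 2) → (∀ i, e i = 2 → M i % 2 = 0) →
    (∀ i, ∀ x ∈ D, -1 < κ i x) →
    (∀ i, σ i = 0 → ∀ x ∈ D, 0 < κ i x) → (∀ i, σ i = 1 → ∀ x ∈ D, κ i x < 0) →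
    (∀ i, σ i = 2 → ∀ x ∈ D, κ i x = 0) → (∀ i, e i = 2 → ∀ x ∈ D, 0 < κ i x) →
    (∀ i, IntegrableOn (fun z : Fin (1 + 1) → ℝ =>
      c i (Fin.init z) * (z (Fin.last 1) ^ M i / (1 + z (Fin.last 1) ^ e i * κ i (Fin.init z))))
      {z : Fin (1 + 1) → ℝ | (Fin.init z : Fin 1 → ℝ) ∈ D ∧ z (Fin.last 1) ∈ Set.Ioo 0 1}) →
    (∀ i, IntegrableOn (fun x => c i x * ∫ θ in Set.Ioo (0 : ℝ) 1, θ ^ M i / (1 + θ ^ e i * κ i x)) D) →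
    V.domain = {z : Fin (1 + 1) → ℝ | (Fin.init z : Fin 1 → ℝ) ∈ D ∧ z (Fin.last 1) ∈ Set.Ioo 0 1} →
    Set.EqOn V.integrand (fun z => a₀ (Fin.init z) +
      ∑ i, c i (Fin.init z) * (z (Fin.last 1) ^ M i / (1 + z (Fin.last 1) ^ e i * κ i (Fin.init z))))
      V.domain →
    (∀ x ∈ D, a₀ x + ∑ i, c i x * ∫ θ in Set.Ioo (0 : ℝ) 1, θ ^ M i / (1 + θ ^ e i * κ i x) = 0) →
    KZ.of V ∈ KZ.relations

open scoped ContDiff in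
/-- **`CircleLogStructure ⟹ CellCloseCSEven ⟹ CellCloseCEven`** (the proof of `cellCloseC_of_cellCloseCS` verbatim, parity
threaded through; the structure theorem is applied to the converted identity, so its exact angle relations only see the
even circle indices — `atanArg = 0` elsewhere). -/
theorem cellCloseCEven_of_cellCloseCSEven (hCLS : CircleLogStructureAt 1) (h : CellCloseCSEven) : CellCloseCEven := by
  intro D V a₀ q c κ M e σ hDo hD ha₀ ha_sm ha₀i hc hc_sm hκ hκ_sm he heven hκ1 hσ0 hσ1 hσ2 hpos hint hL1 hdom hV hpt
  have hs : ∀ i, sgnB σ i = true → ∀ x ∈ D, κ i x ≠ 0 := by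
    intro i hi x hx
    rcases sgnB_true hi with h0 | h1
    · exact (hσ0 i h0 x hx).ne'
    · exact (hσ1 i h1 x hx).ne
  have hs' : ∀ i, sgnB σ i = false → ∀ x ∈ D, κ i x = 0 := fun i hi x hx => hσ2 i (sgnB_false hi) x hx
  obtain ⟨N, E, hE, hEd, hEn, hcell⟩ := circleStructure_cells hCLS hD e (sgnB σ) ha₀ hc hκ he hs hs' hκ1 hpos hpt
  have hED : ∀ d, E d ⊆ D := fun d => (hE d).2.2
  have hcyl_sa : ∀ S : Set (Fin 1 → ℝ), IsSemialgebraic ℚ S →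
      IsSemialgebraic ℚ {z : Fin (1 + 1) → ℝ | (Fin.init z : Fin 1 → ℝ) ∈ S ∧ z (Fin.last 1) ∈ Set.Ioo 0 1} :=
    fun S hS => RTerm.isSemialgebraic_cyl hS
  obtain ⟨Vc, hVcd, hVci, hrel⟩ := exists_restrict_parts_ae (hcyl_sa D hD)
    (fun d => {z : Fin (1 + 1) → ℝ | (Fin.init z : Fin 1 → ℝ) ∈ E d ∧ z (Fin.last 1) ∈ Set.Ioo 0 1})
    (fun d => hcyl_sa _ (hE d).1) (fun d z hz => ⟨hED d hz.1, hz.2⟩)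
    (fun d d' hne => Set.disjoint_left.mpr fun z hz hz' => Set.disjoint_left.mp (hEd hne) hz.1 hz'.1)
    (by
      refine measure_mono_null (fun z hz => ?_) (KZ.volume_setOf_init_mem_eq_zero hEn)
      refine ⟨hz.1.1, fun hU => hz.2 ?_⟩
      obtain ⟨d, hd⟩ := mem_iUnion.mp hU
      exact mem_iUnion.mpr ⟨d, hd, hz.1.2⟩)
    V hdom
  have hVe : ∀ d, KZ.of (Vc d) ∈ KZ.relations := by
    intro d
    obtain ⟨hEsa, hEo, -⟩ := hE d
    obtain ⟨hpoly, R, f, qq, S, f', m, qq', hqq, hprod, hcoef, hqq', hang, hπ, hcoefA⟩ := hcell d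
    refine h (E d) (Vc d) a₀ q c κ M e σ R f qq S f' m qq' hEo hEsa (ha₀.mono (hED d) hEsa) (ha_sm.mono (hED d))
      (ha₀i.mono_set (hED d)) (fun i => (hc i).mono (hED d) hEsa) (fun i => (hc_sm i).mono (hED d))
      (fun i => (hκ i).mono (hED d) hEsa) (fun i => (hκ_sm i).mono (hED d)) he heven
      (fun i x hx => hκ1 i x (hED d hx)) (fun i hi x hx => hσ0 i hi x (hED d hx))
      (fun i hi x hx => hσ1 i hi x (hED d hx)) (fun i hi x hx => hσ2 i hi x (hED d hx))
      (fun i hi x hx => hpos i hi x (hED d hx))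
      (fun i => (hint i).mono_set fun z hz => ⟨hED d hz.1, hz.2⟩) (fun i => (hL1 i).mono_set (hED d))
      (hVcd d) ?_ hpoly hqq hprod hcoef hqq' hang hπ hcoefA
    intro z hz
    rw [hVci d]
    have hz' : z ∈ {z : Fin (1 + 1) → ℝ | (Fin.init z : Fin 1 → ℝ) ∈ E d ∧ z (Fin.last 1) ∈ Set.Ioo 0 1} :=
      hVcd d ▸ hz
    exact hV (by rw [hdom]; exact ⟨hED d hz'.1, hz'.2⟩)
  have eq : KZ.of V = (KZ.of V - ∑ d, KZ.of (Vc d)) + ∑ d, KZ.of (Vc d) := by abel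
  rw [eq]
  exact add_mem hrel (sum_mem fun d _ => hVe d)

end G13
end Summit.KontsevichZagierPeriods.RootDecompRelativeModAbsolute.Rung30571.RegularisedLogLayer.CylLog.Leaf
end
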